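import Literature.AlgebraicGeometry.Motives.AbelianVarietyTateSpecialisationConjFrob
import Literature.AlgebraicGeometry.Motives.AbelianSchemeModelTateSpecialisationFamily
import HarnessLib

/-!
# Tate compatibility of the Frobenius-conjugate companions `Hγ`, `Hγ′` REDUCED TO POINT IDENTITIES — [Shimura 1998, §11.1 Prop. 14 (i); §18.6 p. 129]

Topic `Literature/AlgebraicGeometry/Motives`; namespace `Literature.NumberTheory.DiophantineGeometry.IsAbelianSchemeModel`.  THEOREMS ONLY
(no definition, no named fact, no instance; net Literature debt 0).  Cell `hodgecm-mathlib` (D-0151), row II-1, E4.  B-p20's `Q5Slot conjFrob` (S5cPrime-harness) asks, for ANY companion data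
`Hγ : HomReduction hi.goodReductionAt (ha.goodReductionAt.conjFrob γ hγ p n hq)` / `Hγ′` (reverse), their Tate compatibility
with the PRODUCED data `hi.tateSpecialisation ℓ hℓv` and the TRANSPORTED datum
`(ha.tateSpecialisation ℓ hℓv).conjFrob γ hγ p n hq σ̃ hσa hσ𝔓` (★ p619784).  All Tate-module bookkeeping is discharged here:
each compatibility is EQUIVALENT-BY-CONSTRUCTION to a family of identities between GEOMETRIC POINTS of `Ã_a^{(q)}`
(`proj_conjFrob_equiv` ★ p619784 + `proj_tateSpecialisation_equiv` ★ p617360 + A-p04's `proj_conjTransportTateEquiv(_symm)`):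

* (Q5)  `f̃(red_i x) = π (red_a ((f x)^{σ̃⁻¹}))`  for `f : A_i → A_a^γ`, `x ∈ A_i(K̄)`, `f̃ = Hγ.redHom f`;
* (Q5′) `red_i (g (y^σ̃)) = g̃ (π (red_a y))`     for `g : A_a^γ → A_i`, `y ∈ A_a(K̄)`, `g̃ = Hγ′.redHom g`.

What remains for the Q5 crew is GEOMETRY ONLY: `Hγ.redHom f` is the special fibre of the Néron lift of `f` to the γᵥ-twisted
model (pinned by `redHom_left_comp` through `conjReductionIso`), and the identity is [Shimura1998] §18.6 p. 129
«`(Y^σ)~ = Ỹ^f` … `(t^σ)~ = π(t̃)`» for the twisted model (B-p15 SCOPE-E4-Q5 memo, pieces P1–P5).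
HC_CM is proved only modulo the 7 printed citations until rung 0 closes.
-/

set_option autoImplicit false

noncomputable section

open CategoryTheory AlgebraicGeometry IsDedekindDomain IsDedekindDomain.HeightOneSpectrum
open scoped NumberField
open Literature.NumberTheory.EllipticCurves Literature.NumberTheory.GaloisRepresentations
open Literature.AlgebraicGeometry.Motives (AbelianVariety SchemeOver)
open Literature.AlgebraicGeometry.Motives.AbelianVariety

namespace Literature.NumberTheory.DiophantineGeometry

namespace IsAbelianSchemeModel

variable {F₀ K : Type} [Field F₀] [Field K] [NumberField K] [Algebra F₀ K] {v : HeightOneSpectrum (𝓞 K)}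
  {Aᵢ Aₐ : AbelianVariety K} {𝒜ᵢ 𝒜ₐ : SchemeOver (valuationSubringAtPrime K v)} [GrpObj 𝒜ᵢ] [GrpObj 𝒜ₐ]
  (hi : IsAbelianSchemeModel Aᵢ v 𝒜ᵢ) (ha : IsAbelianSchemeModel Aₐ v 𝒜ₐ) (γ : K ≃ₐ[F₀] K)
  (hγ : IsArithFrobAt (𝓞 F₀) γ v.asIdeal) (p n : ℕ) [ExpChar v.asIdeal.ResidueField p]
  (hq : Nat.card (𝓞 F₀ ⧸ v.asIdeal.under (𝓞 F₀)) = p ^ n)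
  (σt : AlgebraicClosure K ≃+* AlgebraicClosure K)
  (hσa : ∀ a : K, σt (algebraMap K (AlgebraicClosure K) a) = algebraMap K (AlgebraicClosure K) (γ.toRingEquiv a))
  (ℓ : ℕ) [Fact ℓ.Prime] (hℓv : ((ℓ : ℕ) : 𝓞 K) ∉ v.asIdeal)
  (hσ𝔓 : ∀ x : absIntegers (𝓞 K) K, ∃ hx : σt x ∈ absIntegers (𝓞 K) K,
    (⟨σt x, hx⟩ : absIntegers (𝓞 K) K) - x ^ Nat.card (𝓞 F₀ ⧸ v.asIdeal.under (𝓞 F₀)) ∈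
      (ha.tateSpecialisation ℓ hℓv).prime)

/-- **Q5 ⇐ (Q5) on points.**  For ANY companion datum `Hγ : HomReduction (𝒜ᵢ-datum) ((𝒜ₐ-datum)^γ)`, its Tate
compatibility with the produced datum of `𝒜ᵢ` and the transported datum of the conjugate FOLLOWS from the point identities
`f̃ (red_i x) = π (red_a ((f x)^{σ̃⁻¹}))` for all `f : A_i → A_a^γ` and all geometric points `x` of `A_i`
(componentwise on `T_ℓ`: `proj_conjFrob_equiv`, `proj_tateSpecialisation_equiv`, `proj_conjTransportTateEquiv_symm`).
[cite: Shimura1998, §11.1 Prop. 14 (i); §18.6 proof of Thm. 18.6, p. 129] -/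
theorem isTateCompatible_conjFrob_of_forall_geomPointsMap
    (Hγ : GoodReductionAt.HomReduction hi.goodReductionAt (ha.goodReductionAt.conjFrob γ hγ p n hq))
    (h : ∀ (f : Aᵢ ⟶ Aₐ.conjugate γ.toRingEquiv) (x : Aᵢ.geomPoints),
      Hom.geomPointsMap (Hγ.redHom f) (hi.specialFibreReductionHom x) =
        Hom.geomPointsMap (ha.specialFibre.relFrobenius p n)
          (ha.specialFibreReductionHom
            ((conjTransport γ.toRingEquiv σt hσa Aₐ).symm (Hom.geomPointsMap f x)))) :
    Hγ.IsTateCompatible (hi.tateSpecialisation ℓ hℓv)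
      ((ha.tateSpecialisation ℓ hℓv).conjFrob γ hγ p n hq σt hσa hσ𝔓) := by
  intro f a
  refine TateModule.ext fun m => ?_
  -- write `T_ℓ(f) a = E (E⁻¹ (T_ℓ(f) a))` and read both sides componentwise
  have hb : tateModuleMap ℓ f a = conjTransportTateEquiv γ.toRingEquiv σt hσa Aₐ ℓ
      ((conjTransportTateEquiv γ.toRingEquiv σt hσa Aₐ ℓ).symm (tateModuleMap ℓ f a)) :=
    (LinearEquiv.apply_symm_apply _ _).symm
  rw [hb, GoodReductionAt.TateSpecialisation.proj_conjFrob_equiv, proj_tateSpecialisation_equiv,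
    proj_conjTransportTateEquiv_symm, proj_tateModuleMap f a m]
  rw [proj_tateModuleMap (Hγ.redHom f), proj_tateSpecialisation_equiv]
  exact (h f _).symm

/-- **Q5′ ⇐ (Q5′) on points.**  For ANY reverse companion datum `Hγ′ : HomReduction ((𝒜ₐ-datum)^γ) (𝒜ᵢ-datum)`, its
Tate compatibility FOLLOWS from the point identities `red_i (g (y^σ̃)) = g̃ (π (red_a y))` for all `g : A_a^γ → A_i` and
all geometric points `y` of `A_a`. [cite: Shimura1998, §11.1 Prop. 14 (i); §18.6 proof of Thm. 18.6, p. 129] -/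
theorem isTateCompatible_conjFrob'_of_forall_geomPointsMap
    (Hγ' : GoodReductionAt.HomReduction (ha.goodReductionAt.conjFrob γ hγ p n hq) hi.goodReductionAt)
    (h : ∀ (g : Aₐ.conjugate γ.toRingEquiv ⟶ Aᵢ) (y : Aₐ.geomPoints),
      hi.specialFibreReductionHom (Hom.geomPointsMap g (conjTransport γ.toRingEquiv σt hσa Aₐ y)) =
        Hom.geomPointsMap (Hγ'.redHom g)
          (Hom.geomPointsMap (ha.specialFibre.relFrobenius p n) (ha.specialFibreReductionHom y))) :
    Hγ'.IsTateCompatible ((ha.tateSpecialisation ℓ hℓv).conjFrob γ hγ p n hq σt hσa hσ𝔓)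
      (hi.tateSpecialisation ℓ hℓv) := by
  intro g b
  refine TateModule.ext fun m => ?_
  obtain ⟨a, rfl⟩ := (conjTransportTateEquiv γ.toRingEquiv σt hσa Aₐ ℓ).surjective b
  rw [proj_tateSpecialisation_equiv, proj_tateModuleMap g, proj_conjTransportTateEquiv,
    proj_tateModuleMap (Hγ'.redHom g), GoodReductionAt.TateSpecialisation.proj_conjFrob_equiv,
    proj_tateSpecialisation_equiv]
  exact h g _

end IsAbelianSchemeModel

end Literature.NumberTheory.DiophantineGeometry

end
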